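/-
Copyright (c) 2026 the pub-hodgecm-mathlib formalisation cell (harness21).  Prover seat hodgecm-mathlib-K2E3-p26 (g0), Track B «K2-LIT» ∕ h413
(`stmt-HodgeConjecture-24833`), line `K2_E3_EllipticInputs`, corner (11-3ns-res) «NR-3bis» (dealer K2E3-plan (g4) L4 EMIT #4, deal D159), letter (res3-JH) of the
reduction `Theorems/K2E3CharLocIntNearSemisimpleResidualThreeOfCut.lean` (K2E1-p12 (g3) D156).  2026-09-04.
-/
import Summits.HodgeConjecture.HodgeConjecture.Theorems.F0P3U3PrincipalSeriesLettersHold      -- ★ N3 `u3PrincipalSeriesLengthLeTwo_holds`, ★ N2 `u3PrincipalSeriesConstituentEmbeds_holds`; brings ★ J1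
                                                                                            --   `F0P3U3LengthLeTwoOfEmbeds.nontrivial_coinvariants_of_isConstituentOf_cmPrincipalSeries ∕ isSmooth_cmPrincipalSeries`, ★ N1
import Summits.HodgeConjecture.HodgeConjecture.Theorems.F0P2pCmPrincipalSeriesInterface     -- ★ `subsingleton_cmPrincipalSeries_of_not_continuous`; brings ★ `F0P2pTorusPairsAndVacuity.continuous_components_of_continuous_torusCharPair`
import Literature.NumberTheory.Automorphic.UnitaryGroupRankOneTorusCharacters               -- ★ `UnitaryGroup.exists_cmTorusCharPair_eq` (every character of `T₃` is a pair character)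
import Literature.NumberTheory.Automorphic.U3PrincipalSeriesLettersUnfold                   -- ★ `U3PrincipalSeriesLengthLeTwo_iff`
import Literature.NumberTheory.Automorphic.U3PrincipalSeriesJacquetFiltrationUnfold         -- ★ `finiteDimensional_finrank_eq_two_of_U3PrincipalSeriesJacquetFiltration`
import Literature.NumberTheory.Automorphic.JacquetRankStrictMono                            -- ★ `Representation.finrank_coinvariants_eq_one_of_ne_bot_of_ne_top`
import Literature.NumberTheory.Automorphic.UnitaryGroupUnipotentLimitCompactOpen            -- ★ `isLimitOfCompactOpen_cmBorelTriple_N` (every `N`)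
import HarnessLib

/-!
# K2_E3 road (h413), corner (11-3ns-res) «NR-3bis», letter (res3-JH): the principal series `i_G(χ)` of `U(Φ₃)(L⁺_v)` (non-split `v`) has NO chain
# `⊥ < N₁ < N₂ < ⊤` of subrepresentations (EVERY `χ`), a two-dimensional Jacquet module, every constituent has `r_B ≠ 0`, and a proper non-zero
# subrepresentation has a one-dimensional Jacquet module (continuous `χ`)

Cell `pub/hodgecm-mathlib` (D-0151), Track B, seat K2E3-p26 (g0), dealer K2E3-plan (g4) deal D159 (L4 EMIT #4, `K2/STATUS.md` 2026-09-04T15:15:46Z); consumer: the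
binder `hlen₃` of K2E1-p12 (g3)'s D156 reduction (the N = 3 twin of the (qs2-res) cut ★ `K2E3CharLocIntNearIdentityResidualQuasiSplitTwoOfCut`).
`--supports stmt-HodgeConjecture-24833 --as helper`; THEOREMS ONLY (no definition ∕ instance ∕ notation ∕ named fact ∕ `sorry`); never imports `Cruxes/…/Lines`.
COUNT-NEUTRAL.  The N = 3 twin of ★ D121 `K2E3U2PrincipalSeriesNoThreeChain`, and like it a PURE ASSEMBLY of ★ Track A capital — here the «H»-road letters N1 ∕ N2 ∕ N3
of the statement tree of ★ `Rogawski1990.KeysCaseTwo`, ALL discharged (★ `F0P3U3PrincipalSeriesLettersHold`), which are stated for PAIR characters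
`cmTorusCharPair L v χ₁ χ₂` (`χ₁` of `E_w^×`, `χ₂` of `E_w^1`, continuous); the transport to an ARBITRARY character `χ` of `T₃` is ★
`UnitaryGroup.exists_cmTorusCharPair_eq` ([Rogawski1990, §12.1]: every `χ` is a pair) + ★ `continuous_components_of_continuous_torusCharPair` (`χ` continuous ⇒ `χ₁, χ₂`
continuous) + ★ `subsingleton_cmPrincipalSeries_of_not_continuous` (`χ` NOT continuous ⇒ `i_G(χ) = 0`, so its subrepresentation lattice is trivial).
* §1 **`not_bot_lt_lt_lt_top_cmPrincipalSeries_three`** — NO chain `⊥ < N₁ < N₂ < ⊤` in `i_G(χ)`, EVERY `χ` (= ★ D121's head with `2 ↦ 3`; Casselman Cor. 7.1.2 = ★ N3).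
* §2 `jacquet_finrank_eq_two_cmPrincipalSeries_three` — `r_B i_G(χ)` is finite-dimensional of dimension `2` (continuous `χ`; ★ N1 unfolded).
* §3 `nontrivial_coinvariants_of_isConstituentOf_cmPrincipalSeries_three` — every constituent of `i_G(χ)` has a representative with `r_B ≠ 0` (continuous `χ`; ★ J1 at ★ N2):
  no constituent of `i_G(χ)` is supercuspidal.
* §4 `finrank_restrict_eq_one_of_ne_bot_of_ne_top_three` — a proper non-zero subrepresentation of `i_G(χ)` has a ONE-dimensional Jacquet module (continuous `χ`; ★
  `Representation.finrank_coinvariants_eq_one_of_ne_bot_of_ne_top`): the two exponents have multiplicity one along any cut.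
NOT here: the direct-sum dichotomy at the unitary reducibility point ([Rogawski1990, §12.2 (3)], R-group) — S-layer territory of the (res3-Δ) letter.

HONEST LABEL: HC_CM is proved only modulo the 7 printed citations (2 remaining named inputs: hLiu418 = stmt-HodgeConjecture-24832, h413 =
stmt-HodgeConjecture-24833) until rung 0 closes; count-neutral helper (structure letters for the (11-3ns-res) cut; no character estimate is proved here).

## References
* [Casselman1995] W. Casselman, *Introduction to the theory of admissible representations of 𝔭-adic reductive groups* (1995), Lemma 7.1.1 (a), Cor. 7.1.2, Prop. 7.1.3 p. 67;
  Cor. 6.3.9 p. 60.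
* [BernsteinZelevinsky1977] I. N. Bernstein, A. V. Zelevinsky, *Induced representations of reductive 𝔭-adic groups I*, Ann. Sci. ÉNS 10 (1977), Thm. 2.8, §2.12.
* [Rogawski1990] J. D. Rogawski, *Automorphic Representations of Unitary Groups in Three Variables*, Ann. of Math. Stud. 123 (1990), §12.1 pp. 171–172, §12.2 p. 173.
-/

set_option autoImplicit false
set_option linter.dupNamespace false

noncomputable section

open NumberField IsDedekindDomain Topology Module
open scoped Matrix MatrixGroups
open Literature.NumberTheory Literature.NumberTheory.Automorphic Literature.NumberTheory.Automorphic.UnitaryGroup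

namespace Summit.HodgeConjecture.HodgeConjecture.Cruxes.H413.K2E3U3PrincipalSeriesJHStructure

variable (L : Type) [Field L] [NumberField L] [IsCMField L] (v : HeightOneSpectrum (𝓞 ↥(maximalRealSubfield L)))

/-! ## §0 The transport: a continuous character of `T₃` is a pair character with continuous components -/

/-- **Every CONTINUOUS character `χ` of the torus `T₃(L⁺_v)` of `U(Φ₃)(L⁺_v)` is a pair character `cmTorusCharPair L v χ₁ χ₂` with `χ₁`, `χ₂` CONTINUOUS** (★
`exists_cmTorusCharPair_eq` + ★ `continuous_components_of_continuous_torusCharPair`). [cite: Rogawski1990, §12.1 p. 171] -/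
theorem exists_cmTorusCharPair_eq_of_continuous (χ : ↥(cmBorelTriple L 3 v).M →* ℂˣ) (hχ : Continuous fun t => ((χ t : ℂˣ) : ℂ)) :
    ∃ (χ₁ : (LocalRing L v)ˣ →* ℂˣ) (χ₂ : ↥(normOneUnits (conjLocal L (IsCMField.complexConj L) v)) →* ℂˣ),
      Continuous (fun x => ((χ₁ x : ℂˣ) : ℂ)) ∧ Continuous (fun x => ((χ₂ x : ℂˣ) : ℂ)) ∧ cmTorusCharPair L v χ₁ χ₂ = χ := by
  obtain ⟨χ₁, χ₂, hχeq⟩ := exists_cmTorusCharPair_eq L v χ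
  subst hχeq
  obtain ⟨h₁, h₂⟩ := F0P2pTorusPairsAndVacuity.continuous_components_of_continuous_torusCharPair (conjLocal L (IsCMField.complexConj L) v)
    (continuous_conjLocal L (IsCMField.complexConj L) v) (conjLocal_conjLocal_cm L v) (cmLocalForm L 3 v) (cmLocalForm_eq_over L 3 v) χ₁ χ₂ hχ
  exact ⟨χ₁, χ₂, h₁, h₂, rfl⟩

/-! ## §1 NO chain `⊥ < N₁ < N₂ < ⊤` in `i_G(χ)`, every `χ` -/

set_option synthInstance.maxHeartbeats 400000 in  -- instance paths on the CM carrier `∏_{w ∣ v} L_w` (as ★ D121 ∕ ★ `U3PrincipalSeriesLettersUnfold`)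
set_option maxHeartbeats 2000000 in  -- the `rfl`-bridge `cmPrincipalSeries L 3 v χ = normalizedInd (cmBorelTriple L 3 v) (𝟙 ⊗ χ)` under `subst` (cf. ★ D121, 2 M each)
/-- **NO CHAIN `⊥ < N₁ < N₂ < ⊤` IN `i_G(χ)` ON `U(Φ₃)(L⁺_v)`, `v` NON-SPLIT, EVERY `χ`** (the N = 3 twin of ★ D121 `not_bot_lt_lt_lt_top_cmPrincipalSeries_two`; the letter
(res3-JH) `hlen₃` of the (11-3ns-res) cut): for `χ` continuous, `χ = (χ₁, χ₂)` with continuous components (§0) and ★ N3 `u3PrincipalSeriesLengthLeTwo_holds` (Casselman's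
Cor. 7.1.2: the two-dimensional Jacquet module is strictly monotone along chains since every constituent has `r_B ≠ 0`); for `χ` NOT continuous the space of `i_G(χ)` is
`0` (★ `subsingleton_cmPrincipalSeries_of_not_continuous`), so already `⊥ < N₁` fails. [cite: Casselman1995, Cor. 7.1.2 p. 67] [cite: BernsteinZelevinsky1977, Thm. 2.8]
[cite: Rogawski1990, §12.2 p. 173] -/
theorem not_bot_lt_lt_lt_top_cmPrincipalSeries_three (hns : ∀ w : PlacesOver L v, IsCMField.complexConj L • w.1 = w.1)
    (χ : ↥(cmBorelTriple L 3 v).M →* ℂˣ)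
    (N₁ N₂ : Subrepresentation (haveI := locallyCompactSpace_cmBorelU L 3 v; cmPrincipalSeries L 3 v χ)) :
    ¬ (⊥ < N₁ ∧ N₁ < N₂ ∧ N₂ < ⊤) := by
  haveI := locallyCompactSpace_cmBorelU L 3 v
  by_cases hχ : Continuous fun t => ((χ t : ℂˣ) : ℂ)
  · obtain ⟨χ₁, χ₂, h₁, h₂, hχeq⟩ := exists_cmTorusCharPair_eq_of_continuous L v χ hχ
    subst hχeq
    exact (U3PrincipalSeriesLengthLeTwo_iff L).1 (F0P3U3PrincipalSeriesLettersHold.u3PrincipalSeriesLengthLeTwo_holds L) v hns χ₁ χ₂ h₁ h₂ N₁ N₂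
  · haveI := (Submodule.subsingleton_iff ℂ).2 (F0P2pCmPrincipalSeriesInterface.subsingleton_cmPrincipalSeries_of_not_continuous L v χ hχ)
    rintro ⟨h01, -, -⟩
    exact h01.ne (Subrepresentation.toSubmodule_injective (Subsingleton.elim _ _))

/-! ## §2 The Jacquet module of `i_G(χ)` is two-dimensional (continuous `χ`) -/

set_option synthInstance.maxHeartbeats 400000 in  -- instance paths on the CM carrier `∏_{w ∣ v} L_w` (as ★ D121 ∕ ★ `U3PrincipalSeriesLettersUnfold`)
set_option maxHeartbeats 2000000 in  -- the `rfl`-bridge `cmPrincipalSeries L 3 v χ = normalizedInd (cmBorelTriple L 3 v) (𝟙 ⊗ χ)` under `subst` (cf. ★ D121, 2 M each)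
/-- **`r_B i_G(χ)` IS FINITE-DIMENSIONAL OF DIMENSION `2`** on `U(Φ₃)(L⁺_v)` at a non-split `v`, for every CONTINUOUS `χ` (★ N1 `U3PrincipalSeriesJacquetFiltration_holds` unfolded by
★ `finiteDimensional_finrank_eq_two_of_U3PrincipalSeriesJacquetFiltration`, transported through §0). [cite: Casselman1995, Lemma 7.1.1 (a) p. 67] [cite: Rogawski1990, §12.1 p. 171] -/
theorem jacquet_finrank_eq_two_cmPrincipalSeries_three (hns : ∀ w : PlacesOver L v, IsCMField.complexConj L • w.1 = w.1)
    (χ : ↥(cmBorelTriple L 3 v).M →* ℂˣ) (hχ : Continuous fun t => ((χ t : ℂˣ) : ℂ)) :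
    haveI := locallyCompactSpace_cmBorelU L 3 v
    FiniteDimensional ℂ ((cmBorelTriple L 3 v).restrict (cmPrincipalSeries L 3 v χ)).Coinvariants ∧
      Module.finrank ℂ ((cmBorelTriple L 3 v).restrict (cmPrincipalSeries L 3 v χ)).Coinvariants = 2 := by
  obtain ⟨χ₁, χ₂, h₁, h₂, hχeq⟩ := exists_cmTorusCharPair_eq_of_continuous L v χ hχ
  subst hχeq
  exact finiteDimensional_finrank_eq_two_of_U3PrincipalSeriesJacquetFiltration L
    (F0P3U3PrincipalSeriesJacquetFiltrationHolds.U3PrincipalSeriesJacquetFiltration_holds L) v hns χ₁ χ₂ h₁ h₂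

/-! ## §3 Every constituent of `i_G(χ)` has a non-zero Jacquet module (continuous `χ`) -/

set_option synthInstance.maxHeartbeats 400000 in  -- instance paths on the CM carrier `∏_{w ∣ v} L_w` (as ★ D121 ∕ ★ `U3PrincipalSeriesLettersUnfold`)
set_option maxHeartbeats 2000000 in  -- the `rfl`-bridge `cmPrincipalSeries L 3 v χ = normalizedInd (cmBorelTriple L 3 v) (𝟙 ⊗ χ)` under `subst` (cf. ★ D121, 2 M each)
/-- **EVERY CONSTITUENT OF `i_G(χ)` HAS `r_B ≠ 0`** (`χ` continuous, `v` non-split): every irreducible constituent has a representative whose Jacquet module is non-trivial — ★ J1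
`nontrivial_coinvariants_of_isConstituentOf_cmPrincipalSeries` at ★ N2 `u3PrincipalSeriesConstituentEmbeds_holds` (a constituent embeds in `i_G(χ)` or `i_G(wχ)`; Frobenius),
transported through §0.  In particular no constituent of `i_G(χ)` is supercuspidal. [cite: Casselman1995, Cor. 6.3.9 (b) p. 60] [cite: BernsteinZelevinsky1977, §2.12]
[cite: Rogawski1990, §12.2 p. 173] -/
theorem nontrivial_coinvariants_of_isConstituentOf_cmPrincipalSeries_three (hns : ∀ w : PlacesOver L v, IsCMField.complexConj L • w.1 = w.1)
    (χ : ↥(cmBorelTriple L 3 v).M →* ℂˣ) (hχ : Continuous fun t => ((χ t : ℂˣ) : ℂ))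
    (c : IrrClass ↥(unitaryGroupOfForm (conjLocal L (IsCMField.complexConj L) v) (cmLocalForm L 3 v)))
    (hc : c.IsConstituentOf (haveI := locallyCompactSpace_cmBorelU L 3 v; cmPrincipalSeries L 3 v χ)) :
    ∃ r : SmoothIrrep ↥(unitaryGroupOfForm (conjLocal L (IsCMField.complexConj L) v) (cmLocalForm L 3 v)),
      IrrClass.mk r = c ∧ Nontrivial ((cmBorelTriple L 3 v).restrict r.ρ).Coinvariants := by
  obtain ⟨χ₁, χ₂, h₁, h₂, hχeq⟩ := exists_cmTorusCharPair_eq_of_continuous L v χ hχ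
  subst hχeq
  exact F0P3U3LengthLeTwoOfEmbeds.nontrivial_coinvariants_of_isConstituentOf_cmPrincipalSeries L
    (F0P3U3PrincipalSeriesLettersHold.u3PrincipalSeriesConstituentEmbeds_holds L) v hns χ₁ χ₂ h₁ h₂ c hc

/-! ## §4 A proper non-zero subrepresentation has a one-dimensional Jacquet module (continuous `χ`) -/

set_option synthInstance.maxHeartbeats 400000 in  -- instance paths on the CM carrier `∏_{w ∣ v} L_w` (as ★ D121 ∕ ★ `U3PrincipalSeriesLettersUnfold`)
set_option maxHeartbeats 2000000 in  -- the `rfl`-bridge `cmPrincipalSeries L 3 v χ = normalizedInd (cmBorelTriple L 3 v) (𝟙 ⊗ χ)` under `subst` (cf. ★ D121, 2 M each)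
/-- **A PROPER NON-ZERO SUBREPRESENTATION OF `i_G(χ)` HAS A ONE-DIMENSIONAL JACQUET MODULE** (`χ` continuous, `v` non-split): `0 < dim r_B(N) < dim r_B(i_G(χ)) = 2` by the strict
monotonicity of the Jacquet rank (★ `Representation.finrank_coinvariants_eq_one_of_ne_bot_of_ne_top`: exactness ★ `isLimitOfCompactOpen_cmBorelTriple_N`, smoothness ★
`isSmooth_cmPrincipalSeries`, §3 and §2) — the two exponents `χ`, `wχ` have multiplicity one along any cut. [cite: Casselman1995, Prop. 7.1.3 p. 67] [cite: BernsteinZelevinsky1977, Thm. 2.8] -/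
theorem finrank_restrict_eq_one_of_ne_bot_of_ne_top_three (hns : ∀ w : PlacesOver L v, IsCMField.complexConj L • w.1 = w.1)
    (χ : ↥(cmBorelTriple L 3 v).M →* ℂˣ) (hχ : Continuous fun t => ((χ t : ℂˣ) : ℂ))
    {N : Subrepresentation (haveI := locallyCompactSpace_cmBorelU L 3 v; cmPrincipalSeries L 3 v χ)} (hbot : N ≠ ⊥) (htop : N ≠ ⊤) :
    Module.finrank ℂ ((cmBorelTriple L 3 v).restrict N.toRepresentation).Coinvariants = 1 := by
  haveI := locallyCompactSpace_cmBorelU L 3 v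
  have hfd := (jacquet_finrank_eq_two_cmPrincipalSeries_three L v hns χ hχ).1
  have h2 := (jacquet_finrank_eq_two_cmPrincipalSeries_three L v hns χ hχ).2
  haveI := hfd
  exact Representation.finrank_coinvariants_eq_one_of_ne_bot_of_ne_top (cmBorelTriple L 3 v) (isLimitOfCompactOpen_cmBorelTriple_N L 3 v)
    (F0P3U3LengthLeTwoOfEmbeds.isSmooth_cmPrincipalSeries L v χ) (nontrivial_coinvariants_of_isConstituentOf_cmPrincipalSeries_three L v hns χ hχ) h2 hbot htop

end Summit.HodgeConjecture.HodgeConjecture.Cruxes.H413.K2E3U3PrincipalSeriesJHStructure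

end
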